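import Literature.AnabelianGeometry.SemiGraphs.SgAFiniteEtaleCoveringGraphIso
import Literature.AnabelianGeometry.SemiGraphs.CoveringGraphIsoOver
import Literature.AnabelianGeometry.SemiGraphs.SgAToProfiniteConjugator
import Literature.AnabelianGeometry.SemiGraphs.CoveringHomCanPointAlignment
import Literature.AnabelianGeometry.SemiGraphs.MatchedStabilizersOfRestrictGlobal
import HarnessLib

/-!
# [SemiAnbd] Def. 2.2 (i), print's constructed covering `𝒢_A → 𝒢` on the profinite presentation: the
# CANONICAL POINT SYSTEM and its stabiliser dictionary (bridge brick L1d-can, definition layer)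

Mochizuki, *Semi-graphs of anabelioids*, Publ. RIMS **42** (2006), Def. 2.2 (i) p. 23 (the finite étale
covering `𝒢' → 𝒢` ATTACHED TO `G' ∈ Ob(B(𝒢))`: constituents the component anabelioids `(𝒢_v)_P`),
Rmk. 2.2.1 p. 24 ("`Π_{v'}` … the stabilizers") (kurims `paper:url-f33ace170ff4`); the covering is
abc-iut-L3-t5/t6's CONSTRUCTION `BObj.coveringGraph A` / `BObj.coveringHomCan A`
(`CoveringOfObject.lean`, `CoveringHomCanonical.lean`). [cite: MochizukiSemiAnbd2006, Def. 2.2(i) p.23]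

Brick of the (R1) bridge law L1 «finite étale ⇒ tempered» (HOME/staging/L3/L3-t3/R1-BRIDGE-SHAPES.md
§4; interface owner abc-iut-L3-t3).  For `A ∈ B(ℋ)` and the constructed covering
`ψ := coveringHomCan A : 𝒢_A → ℋ`, the inputs of `CovObj.pointIsoOver` (`CoveringGraphIsoOver.lean`)
at `S := BObj.toCovObj A`:

* `BObj.tV A vc` / `tE` — a point of the ONE-POINT fibre `F_{vc}(P = P)` of the terminal object of the
  constituent `(ℋ_v)_P` (model), `P` the component labelled by the vertex `vc = (v, P)` of `𝒢_A`;
* `BObj.yCan A vc ∈ F_v(S_v)` / `zCan` — THE CANONICAL POINTS: `tV` pushed along the unit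
  `(P = P) → (P × P → P) = ψ_{vc}^* P`, the chosen path `γ_{vc}` (B2 `vertexPath`) and `P ↪ S_v`;
  `yCan_mem_range` (it lies in the fibre-image of the labelled component);
* `BObj.stabCondition_can` — (PS2): `Π_{𝒢_A,vc} → Π_{ℋ,v}` is injective with image `Stab(yCan vc)`
  (`range_pi1Map_eq_stabilizer`, Rmk. 2.2.1), edges likewise;
* `BObj.glueCondition_can`, `pointLift_vertexMap_bijective_can` / `…edgeMap…` — (PS1) and the
  bijections, from the choice-agnostic `SgAFiniteEtaleCoveringGraphIso.lean` at the labels `vComp`,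
  `eComp` of the construction;
* `BObj.conjCan A bc vc h'` — the 2-cell conjugator of `ψ` at the branch `bc` for the chosen paths
  (`HomOver.conjOfPaths`), with `hV_brHom_eq_conjCan` (the square of `ψ.toProfinite` at `bc` commutes
  up to `Inn(conjCan)`, in the `castGe` form of `CovObj.PointAligned`).

The remaining clause of (PS3) — `conjCan · glued(zCan) = yCan`, from L4-t17's `alignIso_point` — and
the assembly are the companion `SgACoveringHomCanPointAlignment.lean`.  Definitions + bookkeeping
only; nothing of the paper is asserted; no side taken on [IUTchIII] Cor. 3.12.
-/

noncomputable section

namespace Literature.AnabelianGeometry.SemiGraphs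

open CategoryTheory CategoryTheory.Limits CategoryTheory.PreGaloisCategory
open Literature.AnabelianGeometry.Anabelioids

universe u

namespace SemiGraphOfAnabelioids

namespace BObj

variable {ℋ : SemiGraphOfAnabelioids.{u, u, u}} (A : ℋ.BObj)

/-! ### The models of the component anabelioids and the one-point fibres -/

/-- The model equivalence `(ℋ_v)_P = Over P ≌ (𝒢_A)_{vc}` at the vertex `vc = (v, P)` of `𝒢_A`.
[cite: MochizukiSemiAnbd2006, Def. 2.2(i) p.23] -/
abbrev eV (vc : A.fibreData.total.Vertex) :
    Over ((A.vComp vc).1 : ℋ.V (A.fibreData.proj.vertexMap vc)) ≌ A.coveringGraph.V vc :=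
  Shrink.equivalence (Over ((A.vComp vc).1 : ℋ.V (A.fibreData.proj.vertexMap vc)))

/-- The model equivalence `(ℋ_e)_Q = Over Q ≌ (𝒢_A)_{ec}` at the edge `ec = (e, Q)` of `𝒢_A`.
[cite: MochizukiSemiAnbd2006, Def. 2.2(i) p.23] -/
abbrev eE (ec : A.fibreData.total.Edge) :
    Over ((A.eComp ec).1 : ℋ.E (A.fibreData.proj.edgeMap ec)) ≌ A.coveringGraph.E ec :=
  Shrink.equivalence (Over ((A.eComp ec).1 : ℋ.E (A.fibreData.proj.edgeMap ec)))

/-- A point of the one-point fibre `F_{vc}(P = P)` of the terminal object of `(ℋ_v)_P` (model) at the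
canonical basepoint of `(𝒢_A)_{vc}`. [cite: MochizukiSemiAnbd2006, Def. 2.2(i) p.23] -/
def tV (vc : A.fibreData.total.Vertex) :
    (A.coveringGraph.fibV vc).obj ((A.eV vc).functor.obj (Over.mk (𝟙 _))) :=
  Classical.choice (nonempty_fiber_equiv_mkId (A.eV vc).functor (A.coveringGraph.fibV vc))

/-- A point of the one-point fibre `F_{ec}(Q = Q)`. [cite: MochizukiSemiAnbd2006, Def. 2.2(i) p.23] -/
def tE (ec : A.fibreData.total.Edge) :
    (A.coveringGraph.fibE ec).obj ((A.eE ec).functor.obj (Over.mk (𝟙 _))) :=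
  Classical.choice (nonempty_fiber_equiv_mkId (A.eE ec).functor (A.coveringGraph.fibE ec))

/-! ### The canonical points -/

/-- **The canonical vertex point `y_{vc} ∈ F_v(S_v)`**: the point `tV` of `F_{vc}(P = P)` pushed along
the unit `(P = P) → (P × P → P) = ψ_{vc}^*(P)`, the chosen path `γ_{vc} : ψ_{vc}^* ⋙ F_{vc} ≅ F_v` and
`P ↪ S_v` — the point whose stabiliser is the image of `Π_{𝒢_A, vc}` (`range_pi1Map_eq_stabilizer`).
[cite: MochizukiSemiAnbd2006, Rem. 2.2.1 p.24] -/
def yCan (vc : A.fibreData.total.Vertex) :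
    (ℋ.fibV (A.fibreData.proj.vertexMap vc)).obj (A.S (A.fibreData.proj.vertexMap vc)) :=
  (ℋ.fibV _).map (A.vComp vc).1.arrow
    ((A.coveringHomCan.over.vertexPath vc).hom.app _
      ((A.coveringGraph.fibV vc).map
        ((A.eV vc).functor.map ((Over.forgetAdjStar _).unit.app (Over.mk (𝟙 _)))) (A.tV vc)))

/-- **The canonical edge point `z_{ec} ∈ F_e(T_e)`** (same recipe at the edge `ec = (e, Q)`, path
`edgePath ec e rfl`). [cite: MochizukiSemiAnbd2006, Rem. 2.2.1 p.24] -/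
def zCan (ec : A.fibreData.total.Edge) :
    (ℋ.fibE (A.fibreData.proj.edgeMap ec)).obj (A.T (A.fibreData.proj.edgeMap ec)) :=
  (ℋ.fibE _).map (A.eComp ec).1.arrow
    ((A.coveringHomCan.over.edgePath ec _ rfl).hom.app _
      ((A.coveringGraph.fibE ec).map
        ((A.eE ec).functor.map ((Over.forgetAdjStar _).unit.app (Over.mk (𝟙 _)))) (A.tE ec)))

/-- The canonical vertex point lies in the fibre-image of the labelled component `P = vComp vc`.
[cite: MochizukiSemiAnbd2006, Def. 2.2(i) p.23] -/
theorem yCan_mem_range (vc : A.fibreData.total.Vertex) :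
    A.yCan vc ∈ Set.range ((ℋ.fibV (A.fibreData.proj.vertexMap vc)).map (A.vComp vc).1.arrow) :=
  ⟨_, rfl⟩

/-- The canonical edge point lies in the fibre-image of the labelled component `Q = eComp ec`.
[cite: MochizukiSemiAnbd2006, Def. 2.2(i) p.23] -/
theorem zCan_mem_range (ec : A.fibreData.total.Edge) :
    A.zCan ec ∈ Set.range ((ℋ.fibE (A.fibreData.proj.edgeMap ec)).map (A.eComp ec).1.arrow) :=
  ⟨_, rfl⟩

/-! ### (PS2) the stabiliser dictionary at the canonical points -/

/-- The stabilisers of `toCovObj A` are Mathlib's stabilisers for the `Aut F_v`-action on fibres.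
[cite: MochizukiSemiAnbd2006, Rem. 2.2.1 p.24] -/
theorem toCovObj_stabV_eq (v : ℋ.graph.Vertex) (x : (ℋ.fibV v).obj (A.S v)) :
    BTemp.stab ((toCovObj A).SV v) x = MulAction.stabilizer (Aut (ℋ.fibV v)) x := by
  ext g; exact Iff.rfl

/-- The edge version. [cite: MochizukiSemiAnbd2006, Rem. 2.2.1 p.24] -/
theorem toCovObj_stabE_eq (e : ℋ.graph.Edge) (x : (ℋ.fibE e).obj (A.T e)) :
    BTemp.stab ((toCovObj A).SE e) x = MulAction.stabilizer (Aut (ℋ.fibE e)) x := by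
  ext g; exact Iff.rfl

/-- **`range (Π_{𝒢_A,vc} → Π_{ℋ,v}) = Stab(y_{vc})`** along the chosen path (Rmk 2.2.1;
`range_pi1Map_eq_stabilizer` at the model equivalence, pushed along the mono `P ↪ S_v`).
[cite: MochizukiSemiAnbd2006, Rem. 2.2.1 p.24] -/
theorem range_hVProfinite_can (vc : A.fibreData.total.Vertex) :
    (A.coveringHomCan.over.hVProfinite vc).toMonoidHom.range =
      MulAction.stabilizer (Aut (ℋ.fibV (A.fibreData.proj.vertexMap vc))) (A.yCan vc) := by
  have h := range_pi1Map_eq_stabilizer (A.eV vc).functor (Iso.refl _) (A.coveringGraph.fibV vc)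
    (A.coveringHomCan.over.vertexPath vc) (A.tV vc)
  erw [Iso.refl_inv, NatTrans.id_app, Category.comp_id] at h
  rw [yCan, stabilizer_map_of_mono]
  exact h

/-- The edge version: `range (Π_{𝒢_A,ec} → Π_{ℋ,e}) = Stab(z_{ec})`.
[cite: MochizukiSemiAnbd2006, Rem. 2.2.1 p.24] -/
theorem range_hEAt_can (ec : A.fibreData.total.Edge) :
    (A.coveringHomCan.over.hEAt ec (A.fibreData.proj.edgeMap ec) rfl).toMonoidHom.range =
      MulAction.stabilizer (Aut (ℋ.fibE (A.fibreData.proj.edgeMap ec))) (A.zCan ec) := by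
  have h := range_pi1Map_eq_stabilizer (A.eE ec).functor (Iso.refl _) (A.coveringGraph.fibE ec)
    (A.coveringHomCan.over.edgePath ec _ rfl) (A.tE ec)
  erw [Iso.refl_inv, NatTrans.id_app, Category.comp_id] at h
  rw [zCan, stabilizer_map_of_mono]
  exact h

/-- `Π_{𝒢_A,vc} → Π_{ℋ,v}` is injective (`pi1Map_injective_of_star_comp`).
[cite: MochizukiSemiAnbd2006, Rem. 2.2.1 p.24] -/
theorem hVProfinite_injective_can (vc : A.fibreData.total.Vertex) :
    Function.Injective (A.coveringHomCan.over.hVProfinite vc) :=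
  (Aut.autMulEquivOfIso (A.coveringHomCan.over.vertexPath vc)).injective.comp
    (pi1Map_injective_of_star_comp (A.eV vc).functor (Iso.refl _) (A.coveringGraph.fibV vc))

/-- `Π_{𝒢_A,ec} → Π_{ℋ,e}` is injective. [cite: MochizukiSemiAnbd2006, Rem. 2.2.1 p.24] -/
theorem hEAt_injective_can (ec : A.fibreData.total.Edge) :
    Function.Injective (A.coveringHomCan.over.hEAt ec (A.fibreData.proj.edgeMap ec) rfl) :=
  (Aut.autMulEquivOfIso (A.coveringHomCan.over.edgePath ec _ rfl)).injective.comp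
    (pi1Map_injective_of_star_comp (A.eE ec).functor (Iso.refl _) (A.coveringGraph.fibE ec))

/-- **(PS2) for the constructed covering at the canonical points.** [cite: MochizukiSemiAnbd2006, Rem. 2.2.1 p.24] -/
theorem stabCondition_can :
    (toCovObj A).StabCondition A.coveringHomCan.toProfinite A.yCan A.zCan := by
  refine ⟨fun vc => A.hVProfinite_injective_can vc, fun vc => ?_, fun ec => A.hEAt_injective_can ec,
    fun ec => ?_⟩
  · rw [toCovObj_stabV_eq]; exact A.range_hVProfinite_can vc
  · rw [toCovObj_stabE_eq]; exact A.range_hEAt_can ec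

/-! ### (PS1) and the bijections, from the choice-agnostic brick L1c-iso -/

/-- The local description of print's constructed covering, UNPACKED at its own labels `vComp`/`eComp`:
the clause "`Q` lies under `P` via `ψ_b`" (`brComp_le_branchImage`, as a factorisation).
[cite: MochizukiSemiAnbd2006, Def. 2.2(i) p.23] -/
theorem fac_can (bc : A.fibreData.total.Branch) (vc : A.fibreData.total.Vertex)
    (h' : A.fibreData.total.abuts bc = some vc) :
    ∃ fac : ((A.eComp (A.fibreData.total.edgeOf bc)).1 :
          ℋ.E (A.fibreData.proj.edgeMap (A.fibreData.total.edgeOf bc))) ⟶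
        (ℋ.transportE (A.fibreData.proj.edgeOf_branchMap bc)).obj
          ((ℋ.pull (A.fibreData.proj.branchMap bc) (A.fibreData.proj.vertexMap vc)
            (A.fibreData.proj.abuts_branchMap bc vc h')).pullback.obj
              ((A.vComp vc).1 : ℋ.V (A.fibreData.proj.vertexMap vc))),
      fac ≫ (ℋ.transportE (A.fibreData.proj.edgeOf_branchMap bc)).map
            ((ℋ.pull _ _ (A.fibreData.proj.abuts_branchMap bc vc h')).pullback.map (A.vComp vc).1.arrow ≫
              (A.ψ (A.fibreData.proj.branchMap bc) (A.fibreData.proj.vertexMap vc)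
                (A.fibreData.proj.abuts_branchMap bc vc h')).hom) ≫
          eqToHom (ℋ.transportE_obj_T A (A.fibreData.proj.edgeOf_branchMap bc)) =
        (A.eComp (A.fibreData.total.edgeOf bc)).1.arrow :=
  ⟨A.inclOfLE (abuts_fst h') (A.vComp vc).1 (A.brComp bc).1 (brComp_le_branchImage h'), by
    change A.inclOfLE _ _ _ _ ≫ ((ℋ.pull _ _ _).pullback.map _ ≫ (A.ψ _ _ _).hom) ≫ eqToHom rfl = _
    rw [eqToHom_refl, Category.comp_id]
    exact A.inclOfLE_comp (abuts_fst h') (A.vComp vc).1 (A.brComp bc).1 (brComp_le_branchImage h')⟩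

/-- **(PS1) the gluing condition for the constructed covering at the canonical points.**
[cite: MochizukiSemiAnbd2006, Def. 2.2(i) p.23] -/
theorem glueCondition_can : (toCovObj A).GlueCondition A.fibreData.proj A.yCan A.zCan :=
  HomOver.glueCondition_toCovObj (𝒢 := A.coveringGraph) (f := A.fibreData.proj) (A := A)
    (fun vc => A.vComp vc) (fun ec => A.eComp ec) A.yCan A.zCan
    (fun bc vc h' => A.fac_can bc vc h') A.yCan_mem_range A.zCan_mem_range

/-- The point lift of the constructed covering at the canonical points is bijective on vertices.
[cite: MochizukiSemiAnbd2006, Def. 2.2(i) p.23] -/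
theorem pointLift_vertexMap_bijective_can :
    Function.Bijective ((toCovObj A).pointLift A.fibreData.proj A.yCan A.zCan A.glueCondition_can).vertexMap :=
  ((toCovObj A).pointLift_vertexMap_bijective_iff _ _ _ _).mpr
    (HomOver.pointLift_vertex_bijective (𝒢 := A.coveringGraph) (f := A.fibreData.proj) (A := A)
      (fun vc => A.vComp vc) A.yCan A.vComp_sigma_bijective A.yCan_mem_range)

/-- The point lift of the constructed covering at the canonical points is bijective on edges.
[cite: MochizukiSemiAnbd2006, Def. 2.2(i) p.23] -/
theorem pointLift_edgeMap_bijective_can :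
    Function.Bijective ((toCovObj A).pointLift A.fibreData.proj A.yCan A.zCan A.glueCondition_can).edgeMap :=
  ((toCovObj A).pointLift_edgeMap_bijective_iff _ _ _ _).mpr
    (HomOver.pointLift_edge_bijective (𝒢 := A.coveringGraph) (f := A.fibreData.proj) (A := A)
      (fun ec => A.eComp ec) A.zCan A.eComp_sigma_bijective A.zCan_mem_range)

/-- The base of the constructed covering is proper (verticial cardinalities are preserved).
[cite: MochizukiSemiAnbd2006, Def. 2.2(i) p.23] -/
theorem isProper_can : SemiGraph.IsProper A.fibreData.proj :=
  A.fibreData.isProper_proj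

/-! ### The aligned conjugator of the constructed covering -/

section Conj

variable (bc : A.fibreData.total.Branch) (vc : A.fibreData.total.Vertex)
  (h' : A.fibreData.total.abuts bc = some vc)

/-- **The 2-cell conjugator of `ψ = coveringHomCan A` at the branch `bc`** for the chosen paths
(`HomOver.conjOfPaths` at `branchPath`, `vertexPath`, `edgePath`, `branchPath`).
[cite: MochizukiSemiAnbd2006, Rem. 2.4.2 p.26] -/
def conjCan : Aut (ℋ.fibV (A.fibreData.proj.vertexMap vc)) :=
  A.coveringHomCan.over.conjOfPaths bc vc h' (A.coveringGraph.branchPath bc vc h')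
    (A.coveringHomCan.over.vertexPath vc)
    (A.coveringHomCan.over.edgePath (A.fibreData.total.edgeOf bc)
      (ℋ.graph.edgeOf (A.fibreData.proj.branchMap bc)) (A.fibreData.proj.edgeOf_branchMap bc).symm)
    (ℋ.branchPath (A.fibreData.proj.branchMap bc) (A.fibreData.proj.vertexMap vc) (abuts_fst h'))

/-- **The square of `ψ.toProfinite` at `bc` commutes up to `Inn(conjCan)`**, in the `castGe` form of
`CovObj.PointAligned`. [cite: MochizukiSemiAnbd2006, Rem. 2.4.2 p.26] -/
theorem hV_brHom_eq_conjCan (x : A.coveringGraph.toProfinite.Ge (A.fibreData.total.edgeOf bc)) :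
    A.coveringHomCan.toProfinite.hV vc (A.coveringGraph.toProfinite.brHom bc vc h' x) =
      A.conjCan bc vc h' *
        ℋ.toProfinite.brHom (A.fibreData.proj.branchMap bc) (A.fibreData.proj.vertexMap vc)
          (A.fibreData.proj.abuts_branchMap bc vc h')
          (ℋ.toProfinite.castGe (A.fibreData.proj.edgeOf_branchMap bc).symm
            (A.coveringHomCan.toProfinite.hE (A.fibreData.total.edgeOf bc) x)) *
        (A.conjCan bc vc h')⁻¹ := by
  exact A.coveringHomCan.over.hVOfPath_brHomOfPath_eq_conj bc vc h' (A.coveringGraph.branchPath bc vc h')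
    (A.coveringHomCan.over.vertexPath vc)
    (A.coveringHomCan.over.edgePath (A.fibreData.total.edgeOf bc)
      (ℋ.graph.edgeOf (A.fibreData.proj.branchMap bc)) (A.fibreData.proj.edgeOf_branchMap bc).symm)
    (ℋ.branchPath (A.fibreData.proj.branchMap bc) (A.fibreData.proj.vertexMap vc) (abuts_fst h')) x

end Conj

end BObj

end SemiGraphOfAnabelioids

end Literature.AnabelianGeometry.SemiGraphs

end
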